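import Literature.AnabelianGeometry.SemiGraphs.ArithLevelKerCongruenceSelfNormalizing
import Literature.AnabelianGeometry.SemiGraphs.ArithLevelKerCongruenceChart
import Literature.AnabelianGeometry.SemiGraphs.TemperedPiEdgeConjugatorsChart
import HarnessLib

/-!
# [SemiAnbd] Thm 3.7 (ii) at the deep tree levels of the chart of ANY cofinal Galois tower: `hself` DISCHARGED
# for the integrated Thm 5.4 line, `hK1′ ⟸ hCC` alone (T54-B, proof-only)

Mochizuki, *Semi-graphs of anabelioids*, Publ. RIMS **42** (2006) 221–322, §1 Lem 1.8 (ii)(b) p. 20, §3 Thm 3.7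
(i)/(ii)/(iii) pp. 40–41, §5 Prop 5.2 (i)/(iv) pp. 63–64 [cite: MochizukiSemiAnbd2006, Thm 3.7 (ii), p. 41].

PROOF-ONLY file (abc-iut cell, layer L3, sub-DAG `plan/L3/SUBDAG-SemiAnbd-Thm54.md`, producer row T54-B =
`plan/GAP-LEDGER.md` G-w4d053-1, residual binder «T54·hK1′» → «hCC + hself»; piece (S6) of abc-iut-w6-d117 gen 2).
No definition, no new named fact.  abc-iut-w6-d117's `ArithLevelKerCongruenceSelfNormalizing` (p442124) proves
`hself` at all deep tree levels of the CANONICAL tower `𝒢.galoisLevelData h36`; abc-iut-w4-d089's integrated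
Thm 5.4 line (`ArithLevelKerCongruenceChart`, `ArithThm54IntegratedChartCongruence` p441894) lives at the chart
`D.chart …` of an ARBITRARY cofinal Galois tower `D` with characteristic finite levels and carries `(n₀, hself, hCC)`.
Here `hself` is discharged THERE, in exactly that currency:

* `GaloisLevelData.exists_forall_not_H_le_conj_M_sup_ker_chart` — no vertex group collapses into a positioned
  branch group modulo the deep tree levels of `D` (total elevation `branchSubgroup_ne_top`; Thm 3.7 (i) at the chart
  of the tower: `verticialInjective_holds` + abc-iut-w4-d053's `isVerticialHom_decompHomCont_chart`;
  `map_conj_s_piPresentation_M`; compactness; cofinality);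
* `GaloisLevelData.exists_forall_piPresentation_hself_chart` — `hself` at ALL deep tree levels of `D`
  (abc-iut-w6-d117's generic `SubgroupPresentation.hself_of_isTree_of_not_le`);
* `GaloisLevelData.hK1'_chart_of_eventually_congruenceContinuous` — abc-iut-w4-d089's
  `hK1'_chart_of_eventually_congruenceContinuous_of_hself` with `hself` DISCHARGED: the binder `hK1′` of the
  integrated line ⟸ congruence-continuity `hCC` at the deep tree levels ALONE.

HONEST LABEL: `hCC` (Def 5.1 (i)(c)/(d) + Prop 5.2 (i) at the deep tree levels) remains a DESIGN input on the outer
action; at finite monodromy neither is needed (`ArithLevelKerOpenOfFiniteMonodromy`).  Nothing here refers to the IUT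
corpus; no side is taken on [IUTchIII] Cor. 3.12; typed ≠ proved for the residual inputs.
-/

namespace Literature.AnabelianGeometry.SemiGraphs

namespace ProfiniteSemiGraph

namespace GaloisLevelData

open CategoryTheory Topology Filter
open Literature.AnabelianGeometry.EtaleTheta

universe u w

variable {𝒢 : ProfiniteSemiGraph.{u}} (D : GaloisLevelData 𝒢) (h37 : 𝒢.Thm37Hypotheses)

/-- **No vertex group collapses into a branch group modulo the DEEP tree levels of ANY cofinal Galois tower `D`**:
for every branch `b : ε → w`, `H_w ≰ s_b M_ε s_b⁻¹ ⊔ ker ρ_n` for all `n ≥ n₀(b)` — total elevation, Thm 3.7 (i)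
at `D.chart`, compactness of `Π_b`, cofinality of the tree levels. [cite: MochizukiSemiAnbd2006, Thm 3.7 (i), p. 40] -/
theorem exists_forall_not_H_le_conj_M_sup_ker_chart
    (hcof : ∀ (T : CovObj 𝒢), T.IsTempered → ∀ p : T.Point,
      ∃ i : ℕ, ∀ j, i ≤ j → (D.S j).Splits (T.component p))
    (hcn : 𝒢.graph.IsConnected) (hS : ∀ n, (D.S n).Splits (D.S n)) (hfin : ∀ n, (D.S n).IsFinite)
    (hne : ∀ n, (D.S n).HasNonemptyFibres)
    (T : ∀ w : 𝒢.graph.Vertex, D.PointSeq h37.toProp36Hypotheses.isCountable w) (R : SemiGraph.RefBranches 𝒢.graph)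
    (b : 𝒢.graph.Branch) (w : 𝒢.graph.Vertex)
    (hw : 𝒢.graph.abuts b = some w) :
    ∃ n₀, ∀ n, n₀ ≤ n →
      ¬ (D.piPresentation h37.toProp36Hypotheses.isCountable T R).H w ≤
        ((D.piPresentation h37.toProp36Hypotheses.isCountable T R).M (𝒢.graph.edgeOf b)).map
          (MulAut.conj ((D.piPresentation h37.toProp36Hypotheses.isCountable T R).s b)).toMonoidHom ⊔
        (D.projAut h37.toProp36Hypotheses.isCountable n).ker := by
  haveI := D.t2Space_temperedPi h37.toProp36Hypotheses.isCountable
  -- injectivity of the decomposition homomorphism at `w` (Thm 3.7 (i) at the chart of the tower)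
  have hinj : Function.Injective (T w).decompHom :=
    ((verticialInjective_holds 𝒢 h37 (D.chart h37.toProp36Hypotheses.isCountable hcof hcn hS hfin hne) w).2
      (T w).decompHomCont ((T w).isVerticialHom_decompHomCont_chart hcof hcn hS hfin hne) :)
  have hB := D.map_conj_s_piPresentation_M h37.toProp36Hypotheses.isCountable T R b w hw
  have hH : (D.piPresentation h37.toProp36Hypotheses.isCountable T R).H w =
      (⊤ : Subgroup (𝒢.Gv w)).map (T w).decompHom := by
    rw [D.piPresentation_H h37.toProp36Hypotheses.isCountable T R, MonoidHom.range_eq_map]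
  refine exists_forall_not_le_sup_of_isClosed _ _ ?_ ?_
    (fun n => (D.projAut h37.toProp36Hypotheses.isCountable n).ker) (fun _ => MonoidHom.normal_ker _)
    (D.ker_projAut_anti h37.toProp36Hypotheses.isCountable)
    (fun _ hU => D.exists_ker_projAut_subset h37.toProp36Hypotheses.isCountable hU)
  · rw [hB, Subgroup.coe_map]
    refine (IsCompact.image ?_ (T w).continuous_decompHom).isClosed
    unfold ProfiniteSemiGraph.branchSubgroup
    rw [MonoidHom.coe_range]
    exact isCompact_range (map_continuous (𝒢.brHom b w hw))
  · rw [hB, hH, Subgroup.map_le_map_iff_of_injective hinj, top_le_iff]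
    exact branchSubgroup_ne_top h37.isTotallyElevated hw

variable (hcof : ∀ (T : CovObj 𝒢), T.IsTempered → ∀ p : T.Point,
    ∃ i : ℕ, ∀ j, i ≤ j → (D.S j).Splits (T.component p))
  (hcn : 𝒢.graph.IsConnected) (hS : ∀ n, (D.S n).Splits (D.S n)) (hfin : ∀ n, (D.S n).IsFinite)
  (hne : ∀ n, (D.S n).HasNonemptyFibres)
  (T : ∀ w : 𝒢.graph.Vertex, D.PointSeq h37.toProp36Hypotheses.isCountable w) (R : SemiGraph.RefBranches 𝒢.graph)

/-- **`hself` at ALL DEEP tree levels of the chart of ANY cofinal Galois tower** (finite graph `𝔾`): for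
`n ≥ n₀` and every vertex `w`, the image of `H_w` in `π₁^temp(𝒢) ⧸ ker ρ_n` is self-normalising — the binder `hself`
of abc-iut-w4-d089's `hK1'_chart_of_eventually_congruenceContinuous_of_hself` VERBATIM.
[cite: MochizukiSemiAnbd2006, Thm 3.7 (ii), p. 41] -/
theorem exists_forall_piPresentation_hself_chart (hG : 𝒢.graph.IsGraph) [Finite 𝒢.graph.Branch] :
    ∃ n₀, ∀ n, n₀ ≤ n → ∀ (w : 𝒢.graph.Vertex)
      (q : (D.chart h37.toProp36Hypotheses.isCountable hcof hcn hS hfin hne).G ⧸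
        (D.projAut h37.toProp36Hypotheses.isCountable n).ker),
      (∀ x : (D.chart h37.toProp36Hypotheses.isCountable hcof hcn hS hfin hne).G ⧸
          (D.projAut h37.toProp36Hypotheses.isCountable n).ker,
        x ∈ ((D.piPresentation h37.toProp36Hypotheses.isCountable T R).H w).map (QuotientGroup.mk' _) ↔
        q⁻¹ * x * q ∈ ((D.piPresentation h37.toProp36Hypotheses.isCountable T R).H w).map (QuotientGroup.mk' _)) →
      q ∈ ((D.piPresentation h37.toProp36Hypotheses.isCountable T R).H w).map (QuotientGroup.mk' _) := by
  have hb : ∀ b : 𝒢.graph.Branch, ∃ n₀, ∀ n, n₀ ≤ n → ∀ (w : 𝒢.graph.Vertex), 𝒢.graph.abuts b = some w →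
      ¬ (D.piPresentation h37.toProp36Hypotheses.isCountable T R).H w ≤
        ((D.piPresentation h37.toProp36Hypotheses.isCountable T R).M (𝒢.graph.edgeOf b)).map
          (MulAut.conj ((D.piPresentation h37.toProp36Hypotheses.isCountable T R).s b)).toMonoidHom ⊔
        (D.projAut h37.toProp36Hypotheses.isCountable n).ker := by
    intro b
    obtain ⟨w, hw⟩ := Option.isSome_iff_exists.mp (hG.abuts_isSome b)
    obtain ⟨n₀, hn₀⟩ := D.exists_forall_not_H_le_conj_M_sup_ker_chart h37 hcof hcn hS hfin hne T R b w hw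
    refine ⟨n₀, fun n hn w' hw' => ?_⟩
    obtain rfl : w' = w := Option.some_injective _ (hw'.symm.trans hw)
    exact hn₀ n hn
  choose n₀ hn₀ using hb
  obtain ⟨N, hN⟩ := (Set.finite_range n₀).bddAbove
  refine ⟨N, fun n hn w q hq => ?_⟩
  haveI : ((D.projAut h37.toProp36Hypotheses.isCountable n).ker).Normal := MonoidHom.normal_ker _
  exact (D.piPresentation h37.toProp36Hypotheses.isCountable T R).hself_of_isTree_of_not_le _
    (D.piPresentation_hT h37.toProp36Hypotheses.isCountable T R n) hG
    (D.finite_map_mk_piPresentation_H h37.toProp36Hypotheses.isCountable T R n)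
    (fun b w' hw' => hn₀ b n ((hN ⟨b, rfl⟩).trans hn) w' hw') w q hq

variable (hconn : ∀ (n : ℕ) (p q : (D.S n).Point), (D.S n).SameComponent p q)
  {PA : Type w} [Group PA] [TopologicalSpace PA] [ContinuousMul PA]
  (ρ' : PA →* TopOut (D.chart h37.toProp36Hypotheses.isCountable hcof hcn hS hfin hne).G)
  (baseAct : PA →* Aut 𝒢.graph)
  (hP : (D.piPresentation h37.toProp36Hypotheses.isCountable T R).IsArithCompatible
    (((contMulAut (D.chart h37.toProp36Hypotheses.isCountable hcof hcn hS hfin hne).G).subtype.comp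
      (MonoidHom.fst (contMulAut (D.chart h37.toProp36Hypotheses.isCountable hcof hcn hS hfin hne).G) PA)).comp
        (outerSemidirectProduct ρ').subtype)
    (baseAct.comp (outerSemidirectProductSnd ρ')))
  (d : ℕ → ℕ)
  (hker : ∀ n, (D.piLevelAut h37.toProp36Hypotheses.isCountable hconn n).ker =
    charOpenCore (D.temperedPi h37.toProp36Hypotheses.isCountable) (d n))

/-- **The binder `hK1′` of the integrated Thm 5.4 line (all tree levels of the chart of a cofinal Galois tower
with characteristic levels) ⟸ congruence-continuity `hCC` at the deep tree levels ALONE** — abc-iut-w4-d089's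
`hK1'_chart_of_eventually_congruenceContinuous_of_hself` with `hself` DISCHARGED by
`exists_forall_piPresentation_hself_chart`. [cite: MochizukiSemiAnbd2006, Prop 5.2 (iv), p. 64] -/
theorem hK1'_chart_of_eventually_congruenceContinuous (hG : 𝒢.graph.IsGraph) [Finite 𝒢.graph.Branch]
    (n₁ : ℕ)
    (hCC : ∀ n, n₁ ≤ n → ∃ U ∈ 𝓝 (1 : PA), ∀ a ∈ U, baseAct a = 1 ∧
      ∃ φ : contMulAut (D.chart h37.toProp36Hypotheses.isCountable hcof hcn hS hfin hne).G,
        TopOut.mk (D.chart h37.toProp36Hypotheses.isCountable hcof hcn hS hfin hne).G φ = ρ' a ∧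
        ∀ y : (D.chart h37.toProp36Hypotheses.isCountable hcof hcn hS hfin hne).G,
          (φ : MulAut (D.chart h37.toProp36Hypotheses.isCountable hcof hcn hS hfin hne).G) y * y⁻¹ ∈
          (D.projAut h37.toProp36Hypotheses.isCountable n).ker) :
    ∀ n, IsOpen ((((D.piPresentation h37.toProp36Hypotheses.isCountable T R).levelKer hP
        (D.projAut h37.toProp36Hypotheses.isCountable n).ker
        ((D.hKst_and_hLst_of_ker_piLevelAut_eq_charOpenCore h37.toProp36Hypotheses.isCountable hconn T R ρ' hP
          d hker).1 n)).map (outerSemidirectProductSnd ρ') : Subgroup PA) : Set PA) := by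
  obtain ⟨n₀, hn₀⟩ := D.exists_forall_piPresentation_hself_chart h37 hcof hcn hS hfin hne T R hG
  exact D.hK1'_chart_of_eventually_congruenceContinuous_of_hself h37.toProp36Hypotheses.isCountable hcof hcn hS
    hfin hne hconn ρ' baseAct T R hP d hker hG (max n₀ n₁) (fun n hn => hn₀ n ((le_max_left _ _).trans hn))
    (fun n hn => hCC n ((le_max_right _ _).trans hn))

end GaloisLevelData

end ProfiniteSemiGraph

end Literature.AnabelianGeometry.SemiGraphs
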